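import Summits.Ventures.HSemireg.WeilFrameRealCarrierAllDegrees
import Summits.Ventures.HSemireg.WeilFrameOneSlope

/-!
# Venture HSemireg — the UPPER HALVES and EDGES of TABLE R's `ρ(f) = 1` and `ρ(f) = 2` rows on the real carrier, every `n`
# (palindromy: `R_{2n-k'} = R_{k'}`; so the full rows `(1, 12, 39, 58, 39, 12, 1)` and `(1, 12, 48, 76∕74, 48, 12, 1)` at `n = 3`)

HONEST FRAMING. Part of the Lean index of the computation cell `pub-hsemireg` (seat w3-mod4-1 gen 9, W3 SPECIAL FIBRES;
MOD4-OFFSPLIT TABLE R). The tree's real carriers and the Literature's Weil-type layer ONLY: no semiregularity map, no Ext group, no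
`∫`; nothing here says that HC / HC_CM / HC_AV holds; nothing here is a claim about any explicit variety; no Literature fact is
declared; NO definition is introduced. THIS FILE SITS BEHIND THE FARM BUILD of the gen 6/7 modules (it imports FILE 15).

WHAT IS PROVED (hypotheses of `finrank_S_weilType_middle`; `k + k' = 2n`, `1 ≤ k' ≤ n - 1`): **`finrank_S_twoSlope_deg_dual`**
(`q_m = Aλ^m + Bμ^m`, `A, B ≠ 0`, `λ ≠ μ`: `dim S_k(x) + 4C(n,k') = 4C(2n,k')`), **`finrank_S_oneSlope_deg_dual`** (`q_m = Aλ^m`,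
`A ≠ 0`: `dim S_k(x) + 2C(n,k') = 3C(2n,k')`), and the edge rows **`finrank_S_twoSlope_zero/top`**, **`finrank_S_oneSlope_zero/top`**
(`= 1`; these hold for every `q`, restated for the two shapes for the custodian's convenience). Everything PROVED, 0 sorry.
References: [BuchweitzFlenner2008HH] Prop. 6.4.4; [vanGeemen1994HodgeAV] 4.9; [BourbakiAlgebre1a3] Ch. III §8, §11 no. 9.
-/

noncomputable section

open CliffordAlgebra (contractLeft)
open ExteriorAlgebra (ι)
open Module CategoryTheory
open Literature.AlgebraicGeometry.Motives Literature.AlgebraicGeometry.HodgeTheory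
open Literature.AlgebraicTopology.SingularHomology

namespace Summit.Ventures.HSemireg.WeilFrame

open Summit.Ventures.HSemireg.WedgeBridge Summit.Ventures.HSemireg.WeilCarrier Summit.Ventures.HSemireg.Mod4Carrier
open Summit.Ventures.HSemireg.Wedge.Hankel

section RealCarrier

variable {A : AbelianVariety ℂ}

/-- **`ρ(f) = 2`, UPPER side degrees on the real carrier** (`k + k' = 2n`, `1 ≤ k' ≤ n - 1`): `dim S_k(x) + 4C(n,k') = 4C(2n,k')`.
[cite: BuchweitzFlenner2008HH, Prop. 6.4.4] -/
theorem finrank_S_twoSlope_deg_dual (hA : IsSmoothProjective A.dim A.X) {n d : ℕ} (hdim : A.dim = n + n) (hd : 0 < d)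
    {φ : A ⟶ A} (hφ : φ ≫ φ = -(d • 𝟙 A)) {P Q : Submodule ℂ (complexBetti A.X 1)}
    (hP : P = Module.End.eigenspace (complexBetti.map φ.hom.hom.hom 1).hom (Complex.I * (Real.sqrt d : ℂ)))
    (hQ : Q = Module.End.eigenspace (complexBetti.map φ.hom.hom.hom 1).hom (-(Complex.I * (Real.sqrt d : ℂ))))
    (hp : finrank ℂ ↥(P ⊓ hodgeOneZero hA) = n) {h : complexBetti A.X 2}
    (hh : complexBetti.map φ.hom.hom.hom 2 h = (d : ℂ) • h) (h11 : IsOfHodgeType A.dim A.X 2 1 1 h)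
    (hvol : ((⋀[ℂ]^2 (complexBetti A.X 1)).subtype ((abelianVarietyCohomologyExteriorH1_holds.equiv A 2).symm h)) ^ (n + n) ≠ 0)
    {cP cQ : complexBetti A.X (2 * n)} (hcP : cP ∈ weilClassesPlus A φ n d) (hcP0 : cP ≠ 0)
    (hcQ : cQ ∈ weilClassesMinus A φ n d) (hcQ0 : cQ ≠ 0)
    {Aₛ Bₛ la mu : ℂ} (hAs : Aₛ ≠ 0) (hBs : Bₛ ≠ 0) (hlm : la ≠ mu) {k k' : ℕ} (hk1 : 1 ≤ k') (hkn : k' + 1 ≤ n)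
    (hkk : k + k' = n + n) :
    finrank ℂ ↥(S ℂ (hodgeZeroOne hA) k
        ((∑ m ∈ Finset.range (n + n + 1), ((Aₛ * la ^ m + Bₛ * mu ^ m) * ((m.factorial : ℕ) : ℂ)⁻¹) •
            ((⋀[ℂ]^2 (complexBetti A.X 1)).subtype ((abelianVarietyCohomologyExteriorH1_holds.equiv A 2).symm h)) ^ m) +
          (⋀[ℂ]^(2 * n) (complexBetti A.X 1)).subtype ((abelianVarietyCohomologyExteriorH1_holds.equiv A (2 * n)).symm cP) +
          (⋀[ℂ]^(2 * n) (complexBetti A.X 1)).subtype ((abelianVarietyCohomologyExteriorH1_holds.equiv A (2 * n)).symm cQ))) + 4 * n.choose k' = 4 * (n + n).choose k' := by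
  haveI : Module.Finite ℂ (complexBetti A.X 1) := abelianVarietyCohomologyExteriorH1_holds.finite_one A
  have h : finrank ℂ ↥(S ℂ (hodgeZeroOne hA) k
        ((∑ m ∈ Finset.range (n + n + 1), ((Aₛ * la ^ m + Bₛ * mu ^ m) * ((m.factorial : ℕ) : ℂ)⁻¹) •
            ((⋀[ℂ]^2 (complexBetti A.X 1)).subtype ((abelianVarietyCohomologyExteriorH1_holds.equiv A 2).symm h)) ^ m) +
          (⋀[ℂ]^(2 * n) (complexBetti A.X 1)).subtype ((abelianVarietyCohomologyExteriorH1_holds.equiv A (2 * n)).symm cP) +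
          (⋀[ℂ]^(2 * n) (complexBetti A.X 1)).subtype ((abelianVarietyCohomologyExteriorH1_holds.equiv A (2 * n)).symm cQ))) +
        (n.choose k' + n.choose k') * (hankel1 ℂ (n + n) k' (fun m => Aₛ * la ^ m + Bₛ * mu ^ m)).rank =
      (n + n).choose k' + (n + n).choose k' + (n + n).choose k' * (hankel1 ℂ (n + n) k' (fun m => Aₛ * la ^ m + Bₛ * mu ^ m)).rank :=
    finrank_S_weilType_deg_dual hA hdim hd hφ hP hQ hp hh h11 hvol hcP hcP0 hcQ hcQ0 (fun m => Aₛ * la ^ m + Bₛ * mu ^ m) hk1 hkn hkk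
  rw [Mod4.hankel1_rank_twoSlope hk1 (by omega) hAs hBs hlm] at h
  omega

/-- **`ρ(f) = 1`, UPPER side degrees on the real carrier** (`k + k' = 2n`, `1 ≤ k' ≤ n - 1`): `dim S_k(x) + 2C(n,k') = 3C(2n,k')`.
[cite: BuchweitzFlenner2008HH, Prop. 6.4.4] -/
theorem finrank_S_oneSlope_deg_dual (hA : IsSmoothProjective A.dim A.X) {n d : ℕ} (hdim : A.dim = n + n) (hd : 0 < d)
    {φ : A ⟶ A} (hφ : φ ≫ φ = -(d • 𝟙 A)) {P Q : Submodule ℂ (complexBetti A.X 1)}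
    (hP : P = Module.End.eigenspace (complexBetti.map φ.hom.hom.hom 1).hom (Complex.I * (Real.sqrt d : ℂ)))
    (hQ : Q = Module.End.eigenspace (complexBetti.map φ.hom.hom.hom 1).hom (-(Complex.I * (Real.sqrt d : ℂ))))
    (hp : finrank ℂ ↥(P ⊓ hodgeOneZero hA) = n) {h : complexBetti A.X 2}
    (hh : complexBetti.map φ.hom.hom.hom 2 h = (d : ℂ) • h) (h11 : IsOfHodgeType A.dim A.X 2 1 1 h)
    (hvol : ((⋀[ℂ]^2 (complexBetti A.X 1)).subtype ((abelianVarietyCohomologyExteriorH1_holds.equiv A 2).symm h)) ^ (n + n) ≠ 0)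
    {cP cQ : complexBetti A.X (2 * n)} (hcP : cP ∈ weilClassesPlus A φ n d) (hcP0 : cP ≠ 0)
    (hcQ : cQ ∈ weilClassesMinus A φ n d) (hcQ0 : cQ ≠ 0)
    {Aₛ : ℂ} (la : ℂ) (hAs : Aₛ ≠ 0) {k k' : ℕ} (hk1 : 1 ≤ k') (hkn : k' + 1 ≤ n)
    (hkk : k + k' = n + n) :
    finrank ℂ ↥(S ℂ (hodgeZeroOne hA) k
        ((∑ m ∈ Finset.range (n + n + 1), ((Aₛ * la ^ m) * ((m.factorial : ℕ) : ℂ)⁻¹) •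
            ((⋀[ℂ]^2 (complexBetti A.X 1)).subtype ((abelianVarietyCohomologyExteriorH1_holds.equiv A 2).symm h)) ^ m) +
          (⋀[ℂ]^(2 * n) (complexBetti A.X 1)).subtype ((abelianVarietyCohomologyExteriorH1_holds.equiv A (2 * n)).symm cP) +
          (⋀[ℂ]^(2 * n) (complexBetti A.X 1)).subtype ((abelianVarietyCohomologyExteriorH1_holds.equiv A (2 * n)).symm cQ))) + 2 * n.choose k' = 3 * (n + n).choose k' := by
  haveI : Module.Finite ℂ (complexBetti A.X 1) := abelianVarietyCohomologyExteriorH1_holds.finite_one A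
  have h : finrank ℂ ↥(S ℂ (hodgeZeroOne hA) k
        ((∑ m ∈ Finset.range (n + n + 1), ((Aₛ * la ^ m) * ((m.factorial : ℕ) : ℂ)⁻¹) •
            ((⋀[ℂ]^2 (complexBetti A.X 1)).subtype ((abelianVarietyCohomologyExteriorH1_holds.equiv A 2).symm h)) ^ m) +
          (⋀[ℂ]^(2 * n) (complexBetti A.X 1)).subtype ((abelianVarietyCohomologyExteriorH1_holds.equiv A (2 * n)).symm cP) +
          (⋀[ℂ]^(2 * n) (complexBetti A.X 1)).subtype ((abelianVarietyCohomologyExteriorH1_holds.equiv A (2 * n)).symm cQ))) +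
        (n.choose k' + n.choose k') * (hankel1 ℂ (n + n) k' (fun m => Aₛ * la ^ m)).rank =
      (n + n).choose k' + (n + n).choose k' + (n + n).choose k' * (hankel1 ℂ (n + n) k' (fun m => Aₛ * la ^ m)).rank :=
    finrank_S_weilType_deg_dual hA hdim hd hφ hP hQ hp hh h11 hvol hcP hcP0 hcQ hcQ0 (fun m => Aₛ * la ^ m) hk1 hkn hkk
  rw [Mod4.hankel1_rank_oneSlope (by omega) la hAs] at h
  omega

/-- `ρ(f) = 2`, edge row `0`: `dim S_0(x) = 1`. [cite: BuchweitzFlenner2008HH, Prop. 6.4.4] -/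
theorem finrank_S_twoSlope_zero (hA : IsSmoothProjective A.dim A.X) {n d : ℕ} (hdim : A.dim = n + n) (hd : 0 < d)
    {φ : A ⟶ A} (hφ : φ ≫ φ = -(d • 𝟙 A)) {P Q : Submodule ℂ (complexBetti A.X 1)}
    (hP : P = Module.End.eigenspace (complexBetti.map φ.hom.hom.hom 1).hom (Complex.I * (Real.sqrt d : ℂ)))
    (hQ : Q = Module.End.eigenspace (complexBetti.map φ.hom.hom.hom 1).hom (-(Complex.I * (Real.sqrt d : ℂ))))
    (hp : finrank ℂ ↥(P ⊓ hodgeOneZero hA) = n) {h : complexBetti A.X 2}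
    (hh : complexBetti.map φ.hom.hom.hom 2 h = (d : ℂ) • h) (h11 : IsOfHodgeType A.dim A.X 2 1 1 h)
    (hvol : ((⋀[ℂ]^2 (complexBetti A.X 1)).subtype ((abelianVarietyCohomologyExteriorH1_holds.equiv A 2).symm h)) ^ (n + n) ≠ 0)
    {cP cQ : complexBetti A.X (2 * n)} (hcP : cP ∈ weilClassesPlus A φ n d) (hcP0 : cP ≠ 0)
    (hcQ : cQ ∈ weilClassesMinus A φ n d) (hcQ0 : cQ ≠ 0)
    (Aₛ Bₛ la mu : ℂ) (hn : 1 ≤ n) :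
    finrank ℂ ↥(S ℂ (hodgeZeroOne hA) 0
        ((∑ m ∈ Finset.range (n + n + 1), ((Aₛ * la ^ m + Bₛ * mu ^ m) * ((m.factorial : ℕ) : ℂ)⁻¹) •
            ((⋀[ℂ]^2 (complexBetti A.X 1)).subtype ((abelianVarietyCohomologyExteriorH1_holds.equiv A 2).symm h)) ^ m) +
          (⋀[ℂ]^(2 * n) (complexBetti A.X 1)).subtype ((abelianVarietyCohomologyExteriorH1_holds.equiv A (2 * n)).symm cP) +
          (⋀[ℂ]^(2 * n) (complexBetti A.X 1)).subtype ((abelianVarietyCohomologyExteriorH1_holds.equiv A (2 * n)).symm cQ))) = 1 :=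
  finrank_S_weilType_zero hA hdim hd hφ hP hQ hp hh h11 hvol hcP hcP0 hcQ hcQ0 hn (fun m => Aₛ * la ^ m + Bₛ * mu ^ m)

/-- `ρ(f) = 2`, edge row `2n`: `dim S_{2n}(x) = 1`. [cite: BuchweitzFlenner2008HH, Prop. 6.4.4] -/
theorem finrank_S_twoSlope_top (hA : IsSmoothProjective A.dim A.X) {n d : ℕ} (hdim : A.dim = n + n) (hd : 0 < d)
    {φ : A ⟶ A} (hφ : φ ≫ φ = -(d • 𝟙 A)) {P Q : Submodule ℂ (complexBetti A.X 1)}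
    (hP : P = Module.End.eigenspace (complexBetti.map φ.hom.hom.hom 1).hom (Complex.I * (Real.sqrt d : ℂ)))
    (hQ : Q = Module.End.eigenspace (complexBetti.map φ.hom.hom.hom 1).hom (-(Complex.I * (Real.sqrt d : ℂ))))
    (hp : finrank ℂ ↥(P ⊓ hodgeOneZero hA) = n) {h : complexBetti A.X 2}
    (hh : complexBetti.map φ.hom.hom.hom 2 h = (d : ℂ) • h) (h11 : IsOfHodgeType A.dim A.X 2 1 1 h)
    (hvol : ((⋀[ℂ]^2 (complexBetti A.X 1)).subtype ((abelianVarietyCohomologyExteriorH1_holds.equiv A 2).symm h)) ^ (n + n) ≠ 0)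
    {cP cQ : complexBetti A.X (2 * n)} (hcP : cP ∈ weilClassesPlus A φ n d) (hcP0 : cP ≠ 0)
    (hcQ : cQ ∈ weilClassesMinus A φ n d) (hcQ0 : cQ ≠ 0)
    (Aₛ Bₛ la mu : ℂ) (hn : 1 ≤ n) :
    finrank ℂ ↥(S ℂ (hodgeZeroOne hA) (n + n)
        ((∑ m ∈ Finset.range (n + n + 1), ((Aₛ * la ^ m + Bₛ * mu ^ m) * ((m.factorial : ℕ) : ℂ)⁻¹) •
            ((⋀[ℂ]^2 (complexBetti A.X 1)).subtype ((abelianVarietyCohomologyExteriorH1_holds.equiv A 2).symm h)) ^ m) +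
          (⋀[ℂ]^(2 * n) (complexBetti A.X 1)).subtype ((abelianVarietyCohomologyExteriorH1_holds.equiv A (2 * n)).symm cP) +
          (⋀[ℂ]^(2 * n) (complexBetti A.X 1)).subtype ((abelianVarietyCohomologyExteriorH1_holds.equiv A (2 * n)).symm cQ))) = 1 :=
  finrank_S_weilType_top hA hdim hd hφ hP hQ hp hh h11 hvol hcP hcP0 hcQ hcQ0 hn (fun m => Aₛ * la ^ m + Bₛ * mu ^ m)

/-- `ρ(f) = 1`, edge row `0`: `dim S_0(x) = 1`. [cite: BuchweitzFlenner2008HH, Prop. 6.4.4] -/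
theorem finrank_S_oneSlope_zero (hA : IsSmoothProjective A.dim A.X) {n d : ℕ} (hdim : A.dim = n + n) (hd : 0 < d)
    {φ : A ⟶ A} (hφ : φ ≫ φ = -(d • 𝟙 A)) {P Q : Submodule ℂ (complexBetti A.X 1)}
    (hP : P = Module.End.eigenspace (complexBetti.map φ.hom.hom.hom 1).hom (Complex.I * (Real.sqrt d : ℂ)))
    (hQ : Q = Module.End.eigenspace (complexBetti.map φ.hom.hom.hom 1).hom (-(Complex.I * (Real.sqrt d : ℂ))))
    (hp : finrank ℂ ↥(P ⊓ hodgeOneZero hA) = n) {h : complexBetti A.X 2}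
    (hh : complexBetti.map φ.hom.hom.hom 2 h = (d : ℂ) • h) (h11 : IsOfHodgeType A.dim A.X 2 1 1 h)
    (hvol : ((⋀[ℂ]^2 (complexBetti A.X 1)).subtype ((abelianVarietyCohomologyExteriorH1_holds.equiv A 2).symm h)) ^ (n + n) ≠ 0)
    {cP cQ : complexBetti A.X (2 * n)} (hcP : cP ∈ weilClassesPlus A φ n d) (hcP0 : cP ≠ 0)
    (hcQ : cQ ∈ weilClassesMinus A φ n d) (hcQ0 : cQ ≠ 0)
    (Aₛ la : ℂ) (hn : 1 ≤ n) :
    finrank ℂ ↥(S ℂ (hodgeZeroOne hA) 0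
        ((∑ m ∈ Finset.range (n + n + 1), ((Aₛ * la ^ m) * ((m.factorial : ℕ) : ℂ)⁻¹) •
            ((⋀[ℂ]^2 (complexBetti A.X 1)).subtype ((abelianVarietyCohomologyExteriorH1_holds.equiv A 2).symm h)) ^ m) +
          (⋀[ℂ]^(2 * n) (complexBetti A.X 1)).subtype ((abelianVarietyCohomologyExteriorH1_holds.equiv A (2 * n)).symm cP) +
          (⋀[ℂ]^(2 * n) (complexBetti A.X 1)).subtype ((abelianVarietyCohomologyExteriorH1_holds.equiv A (2 * n)).symm cQ))) = 1 :=
  finrank_S_weilType_zero hA hdim hd hφ hP hQ hp hh h11 hvol hcP hcP0 hcQ hcQ0 hn (fun m => Aₛ * la ^ m)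

/-- `ρ(f) = 1`, edge row `2n`: `dim S_{2n}(x) = 1`. [cite: BuchweitzFlenner2008HH, Prop. 6.4.4] -/
theorem finrank_S_oneSlope_top (hA : IsSmoothProjective A.dim A.X) {n d : ℕ} (hdim : A.dim = n + n) (hd : 0 < d)
    {φ : A ⟶ A} (hφ : φ ≫ φ = -(d • 𝟙 A)) {P Q : Submodule ℂ (complexBetti A.X 1)}
    (hP : P = Module.End.eigenspace (complexBetti.map φ.hom.hom.hom 1).hom (Complex.I * (Real.sqrt d : ℂ)))
    (hQ : Q = Module.End.eigenspace (complexBetti.map φ.hom.hom.hom 1).hom (-(Complex.I * (Real.sqrt d : ℂ))))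
    (hp : finrank ℂ ↥(P ⊓ hodgeOneZero hA) = n) {h : complexBetti A.X 2}
    (hh : complexBetti.map φ.hom.hom.hom 2 h = (d : ℂ) • h) (h11 : IsOfHodgeType A.dim A.X 2 1 1 h)
    (hvol : ((⋀[ℂ]^2 (complexBetti A.X 1)).subtype ((abelianVarietyCohomologyExteriorH1_holds.equiv A 2).symm h)) ^ (n + n) ≠ 0)
    {cP cQ : complexBetti A.X (2 * n)} (hcP : cP ∈ weilClassesPlus A φ n d) (hcP0 : cP ≠ 0)
    (hcQ : cQ ∈ weilClassesMinus A φ n d) (hcQ0 : cQ ≠ 0)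
    (Aₛ la : ℂ) (hn : 1 ≤ n) :
    finrank ℂ ↥(S ℂ (hodgeZeroOne hA) (n + n)
        ((∑ m ∈ Finset.range (n + n + 1), ((Aₛ * la ^ m) * ((m.factorial : ℕ) : ℂ)⁻¹) •
            ((⋀[ℂ]^2 (complexBetti A.X 1)).subtype ((abelianVarietyCohomologyExteriorH1_holds.equiv A 2).symm h)) ^ m) +
          (⋀[ℂ]^(2 * n) (complexBetti A.X 1)).subtype ((abelianVarietyCohomologyExteriorH1_holds.equiv A (2 * n)).symm cP) +
          (⋀[ℂ]^(2 * n) (complexBetti A.X 1)).subtype ((abelianVarietyCohomologyExteriorH1_holds.equiv A (2 * n)).symm cQ))) = 1 :=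
  finrank_S_weilType_top hA hdim hd hφ hP hQ hp hh h11 hvol hcP hcP0 hcQ hcQ0 hn (fun m => Aₛ * la ^ m)

end RealCarrier

end Summit.Ventures.HSemireg.WeilFrame

end
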